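import Mathlib

/-!
# Free (law-dependent) flip kernels carry no content

This file is a small, self-contained, kernel-checked certificate for the debate around the crux
`MeckeRigidity` (`stmt-CriticalPhenomena-14826`, route `CardyMeckeFlip`): at *lattice level*, a
"flip identity" whose kernel is allowed to depend on the law has **no content whatsoever**.

## Setting

* `Ω` is a finite configuration space, `E` a finite set of "edges"/"sites", and `T : E → Ω → Ω`
  a family of flips, each an involution (`hT : ∀ e ω, T e (T e ω) = ω`); think of
  `Ω = (E → Bool)` and `T e` = "toggle coordinate `e`".
* A *law* is a weight `P : Ω → ℝ` (a probability law when `∑ ω, P ω = 1`), a *kernel* is a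
  function `w : Ω → E → ℝ` (think: `w ω e` = intensity of the flip `ω ↦ T e ω`, e.g. the
  indicator that `e` is pivotal in `ω`).
* `FreeKernelNoContent.FlipFair T P w` is the lattice Mecke/flip identity **(F)**: the Campbell
  sum `∑ ω, ∑ e, P ω * w ω e * h ω e` is invariant under precomposing the test function with the
  flips, `h ω e ↦ h (T e ω) e`.
* `FreeKernelNoContent.tilted T φ a` is the square-root-tilted kernel
  `a ω e * √(φ (T e ω) / φ ω)` of a positive law `φ` with a flip-symmetric factor `a`
  (e.g. `a` = indicator of "`e` is pivotal", which is symmetric under flipping `e`).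

## Results

1. `flipFair_iff_detailedBalance`: **(F)** is equivalent to detailed balance
   `P (T e ω) * w (T e ω) e = P ω * w ω e`.
2. `flipFair_tilted`: *every* strictly positive law `φ` is flip-fair for its own tilted kernel.
3. `ratio_eq_of_flipFair_tilted`, `eq_of_flipFair_tilted`: conversely, a law that is flip-fair
   for the tilted kernel of `φ` has `P / φ` constant across positive-`a` flips; hence, under
   flip-connectivity, `φ` is the **unique** flip-fair probability law for that kernel.
4. `extremal_of_flipFair_tilted`: in particular `φ` is (trivially) *extremal* **(EXT)** among
   the flip-fair probability laws of its tilted kernel (the midpoint hypothesis is not even used).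
5. `flipFair_untilted_iff`: by contrast, for the *untilted* symmetric kernel `w = a` the
   identity **(F)** says exactly `a ω e * P (T e ω) = a ω e * P ω`, i.e. flip-invariance of `P`
   across every `a`-positive flip — fair coins on the pivotal edges.

## Moral

With a law-dependent ("free") kernel, both the flip identity **(F)** and flip-extremality
**(EXT)** are automatic at lattice level for EVERY finite-energy law — e.g. for the self-dual
FK(`q`) random-cluster measure with any `q`, not only for Bernoulli(1/2) percolation — so neither
axiom can single out the percolation universality class.  The genuinely "fair-coin" content of a
Mecke-type axiom resides only in the *normalisation of the kernel* (`flipFair_untilted_iff`).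
All proofs are elementary manipulations of finite sums.
-/

namespace FreeKernelNoContent

open Finset BigOperators Real

variable {Ω E : Type*} [Fintype Ω] [Fintype E] [DecidableEq Ω]

/-- **(F)**, the lattice flip (Mecke) identity for a law `P` and a kernel `w`: the Campbell sum
`∑ ω, ∑ e, P ω * w ω e * h ω e` is invariant under `h ω e ↦ h (T e ω) e`. -/
def FlipFair (T : E → Ω → Ω) (P : Ω → ℝ) (w : Ω → E → ℝ) : Prop :=
  ∀ h : Ω → E → ℝ, ∑ ω, ∑ e, P ω * w ω e * h (T e ω) e = ∑ ω, ∑ e, P ω * w ω e * h ω e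

/-- The square-root-tilted kernel of a law `φ` with (flip-symmetric) prefactor `a`:
`tilted T φ a ω e = a ω e * √(φ (T e ω) / φ ω)`. -/
noncomputable def tilted (T : E → Ω → Ω) (φ : Ω → ℝ) (a : Ω → E → ℝ) : Ω → E → ℝ :=
  fun ω e => a ω e * Real.sqrt (φ (T e ω) / φ ω)

/-! ### An indicator test function and the reindexing lemma -/

/-- The indicator test function of the flip pair `(ω₀, e₀)`. -/
def pairIndicator [DecidableEq E] (ω₀ : Ω) (e₀ : E) (ω : Ω) (e : E) : ℝ :=
  if e = e₀ then (if ω = ω₀ then 1 else 0) else 0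

/-- Testing a double sum against `pairIndicator ω₀ e₀` evaluates the integrand at `(ω₀, e₀)`. -/
theorem sum_sum_mul_pairIndicator [DecidableEq E] (F : Ω → E → ℝ) (ω₀ : Ω) (e₀ : E) :
    ∑ ω, ∑ e, F ω e * pairIndicator ω₀ e₀ ω e = F ω₀ e₀ := by
  simp only [pairIndicator, mul_ite, mul_one, mul_zero, Finset.sum_ite_eq', Finset.mem_univ,
    if_true]

omit [DecidableEq Ω] in
/-- Reindexing the flipped Campbell sum by the involutions `T e`: the flip can be moved from the
test function onto the weight `P ω * w ω e`. -/
theorem sum_flip_reindex {T : E → Ω → Ω} (hT : ∀ e ω, T e (T e ω) = ω)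
    (P : Ω → ℝ) (w h : Ω → E → ℝ) :
    ∑ ω, ∑ e, P ω * w ω e * h (T e ω) e = ∑ ω, ∑ e, P (T e ω) * w (T e ω) e * h ω e := by
  rw [Finset.sum_comm]
  conv_rhs => rw [Finset.sum_comm]
  refine Finset.sum_congr rfl fun e _ => ?_
  have hinv : Function.Involutive (T e) := hT e
  calc ∑ ω, P ω * w ω e * h (T e ω) e
      = ∑ ω, P (T e (T e ω)) * w (T e (T e ω)) e * h (T e ω) e := by simp only [hT]
    _ = ∑ ω, P (T e ω) * w (T e ω) e * h ω e :=
        hinv.bijective.sum_comp fun ω => P (T e ω) * w (T e ω) e * h ω e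

/-! ### Theorem 1: the flip identity is detailed balance -/

/-- **Theorem 1.** For involutive flips, the flip identity **(F)** for `(P, w)` is equivalent to
*detailed balance*: `P (T e ω) * w (T e ω) e = P ω * w ω e` for every configuration `ω` and every
flip `e`.  (`→`: test against the indicator of the pair `(ω₀, e₀)`; `←`: reindex by `T e`.) -/
theorem flipFair_iff_detailedBalance {T : E → Ω → Ω} (hT : ∀ e ω, T e (T e ω) = ω)
    (P : Ω → ℝ) (w : Ω → E → ℝ) :
    FlipFair T P w ↔ ∀ ω e, P (T e ω) * w (T e ω) e = P ω * w ω e := by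
  constructor
  · intro hF ω₀ e₀
    classical
    calc P (T e₀ ω₀) * w (T e₀ ω₀) e₀
        = ∑ ω, ∑ e, P (T e ω) * w (T e ω) e * pairIndicator ω₀ e₀ ω e :=
          (sum_sum_mul_pairIndicator (fun ω e => P (T e ω) * w (T e ω) e) ω₀ e₀).symm
      _ = ∑ ω, ∑ e, P ω * w ω e * pairIndicator ω₀ e₀ (T e ω) e :=
          (sum_flip_reindex hT P w (pairIndicator ω₀ e₀)).symm
      _ = ∑ ω, ∑ e, P ω * w ω e * pairIndicator ω₀ e₀ ω e := hF (pairIndicator ω₀ e₀)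
      _ = P ω₀ * w ω₀ e₀ := sum_sum_mul_pairIndicator (fun ω e => P ω * w ω e) ω₀ e₀
  · intro hDB h
    rw [sum_flip_reindex hT P w h]
    simp only [hDB]

/-! ### Theorem 2: every positive law is flip-fair for its tilted kernel -/

/-- Square-root bookkeeping: `y * √(x / y) = √(x * y)` for `0 ≤ x`, `0 ≤ y`. -/
theorem mul_sqrt_div {x y : ℝ} (hx : 0 ≤ x) (hy : 0 ≤ y) :
    y * Real.sqrt (x / y) = Real.sqrt (x * y) := by
  calc y * Real.sqrt (x / y) = Real.sqrt x * (y / Real.sqrt y) := by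
        rw [Real.sqrt_div' x hy]; ring
    _ = Real.sqrt (x * y) := by rw [Real.div_sqrt, Real.sqrt_mul hx]

omit [Fintype Ω] [Fintype E] [DecidableEq Ω] in
/-- Detailed balance of a positive law `φ` with respect to its own tilted kernel: both sides equal
`a ω e * √(φ ω * φ (T e ω))`. -/
theorem tilted_detailedBalance {T : E → Ω → Ω} (hT : ∀ e ω, T e (T e ω) = ω) {φ : Ω → ℝ}
    (hφ : ∀ ω, 0 < φ ω) {a : Ω → E → ℝ} (ha : ∀ ω e, a (T e ω) e = a ω e) (ω : Ω) (e : E) :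
    φ (T e ω) * tilted T φ a (T e ω) e = φ ω * tilted T φ a ω e := by
  show φ (T e ω) * (a (T e ω) e * Real.sqrt (φ (T e (T e ω)) / φ (T e ω)))
    = φ ω * (a ω e * Real.sqrt (φ (T e ω) / φ ω))
  rw [hT, ha]
  calc φ (T e ω) * (a ω e * Real.sqrt (φ ω / φ (T e ω)))
      = a ω e * (φ (T e ω) * Real.sqrt (φ ω / φ (T e ω))) := by ring
    _ = a ω e * Real.sqrt (φ ω * φ (T e ω)) := by
        rw [mul_sqrt_div (hφ ω).le (hφ (T e ω)).le]
    _ = a ω e * Real.sqrt (φ (T e ω) * φ ω) := by rw [mul_comm (φ ω)]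
    _ = a ω e * (φ ω * Real.sqrt (φ (T e ω) / φ ω)) := by
        rw [mul_sqrt_div (hφ (T e ω)).le (hφ ω).le]
    _ = φ ω * (a ω e * Real.sqrt (φ (T e ω) / φ ω)) := by ring

/-- **Theorem 2.** Every strictly positive law `φ` satisfies the flip identity **(F)** for its own
square-root-tilted kernel `tilted T φ a`, for any flip-symmetric prefactor `a`.  Thus, with a
law-dependent kernel, **(F)** holds for *every* finite-energy law. -/
theorem flipFair_tilted {T : E → Ω → Ω} (hT : ∀ e ω, T e (T e ω) = ω) {φ : Ω → ℝ}
    (hφ : ∀ ω, 0 < φ ω) {a : Ω → E → ℝ} (ha : ∀ ω e, a (T e ω) e = a ω e) :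
    FlipFair T φ (tilted T φ a) :=
  (flipFair_iff_detailedBalance hT φ _).2 (tilted_detailedBalance hT hφ ha)

/-! ### Theorem 3: flip-fairness for the tilted kernel pins down the likelihood ratio -/

/-- **Theorem 3.** If `P` is flip-fair for the tilted kernel of the positive law `φ`, then the
likelihood ratio `P / φ` is invariant across every flip of positive prefactor:
`P (T e ω) / φ (T e ω) = P ω / φ ω` whenever `0 < a ω e`. -/
theorem ratio_eq_of_flipFair_tilted {T : E → Ω → Ω} (hT : ∀ e ω, T e (T e ω) = ω)
    {φ : Ω → ℝ} (hφ : ∀ ω, 0 < φ ω) {a : Ω → E → ℝ} (ha : ∀ ω e, a (T e ω) e = a ω e)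
    {P : Ω → ℝ} (hP : FlipFair T P (tilted T φ a)) {ω : Ω} {e : E} (hae : 0 < a ω e) :
    P (T e ω) / φ (T e ω) = P ω / φ ω := by
  have h1 : P (T e ω) * tilted T φ a (T e ω) e = P ω * tilted T φ a ω e :=
    (flipFair_iff_detailedBalance hT P _).1 hP ω e
  have h2 : φ (T e ω) * tilted T φ a (T e ω) e = φ ω * tilted T φ a ω e :=
    tilted_detailedBalance hT hφ ha ω e
  have hk : 0 < tilted T φ a ω e :=
    mul_pos hae (Real.sqrt_pos.2 (div_pos (hφ _) (hφ _)))
  have hk' : 0 < tilted T φ a (T e ω) e := by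
    show 0 < a (T e ω) e * Real.sqrt (φ (T e (T e ω)) / φ (T e ω))
    rw [hT, ha]
    exact mul_pos hae (Real.sqrt_pos.2 (div_pos (hφ _) (hφ _)))
  rw [div_eq_div_iff (hφ (T e ω)).ne' (hφ ω).ne']
  have key : (P (T e ω) * φ ω - P ω * φ (T e ω))
      * (tilted T φ a ω e * tilted T φ a (T e ω) e) = 0 := by
    linear_combination (φ ω * tilted T φ a ω e) * h1 - (P ω * tilted T φ a ω e) * h2
  exact sub_eq_zero.1 ((mul_eq_zero.1 key).resolve_right (mul_pos hk hk').ne')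

/-! ### Theorem 4: uniqueness of the flip-fair law for the tilted kernel -/

/-- **Theorem 4 (uniqueness).** Let `φ` be a strictly positive probability law, `a` a
flip-symmetric prefactor such that any two configurations are joined by a chain of flips of
positive prefactor.  Then `φ` is the *unique* probability law which is flip-fair for the tilted
kernel `tilted T φ a`: the ratio `P / φ` is constant by Theorem 3 and connectivity, and the
constant is `1` by normalisation. -/
theorem eq_of_flipFair_tilted {T : E → Ω → Ω} (hT : ∀ e ω, T e (T e ω) = ω)
    {φ : Ω → ℝ} (hφ : ∀ ω, 0 < φ ω) {a : Ω → E → ℝ} (ha : ∀ ω e, a (T e ω) e = a ω e)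
    (hsumφ : ∑ ω, φ ω = 1)
    (hconn : ∀ ω ω', Relation.ReflTransGen (fun x y => ∃ e, 0 < a x e ∧ y = T e x) ω ω')
    {P : Ω → ℝ} (hsumP : ∑ ω, P ω = 1) (hP : FlipFair T P (tilted T φ a)) : P = φ := by
  -- the likelihood ratio is constant along chains of positive-prefactor flips
  have hratio : ∀ {ω ω' : Ω},
      Relation.ReflTransGen (fun x y => ∃ e, 0 < a x e ∧ y = T e x) ω ω' →
      P ω' / φ ω' = P ω / φ ω := by
    intro ω ω' h
    induction h with
    | refl => rfl
    | tail _ hbc ih =>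
      obtain ⟨e, hae, rfl⟩ := hbc
      rw [ratio_eq_of_flipFair_tilted hT hφ ha hP hae, ih]
  -- fix a base point `ω₀`; then `P = c • φ` with `c = P ω₀ / φ ω₀`, and `c = 1` by normalisation
  funext ω₀
  have hPc : ∀ ω, P ω = P ω₀ / φ ω₀ * φ ω := fun ω =>
    (div_eq_iff (hφ ω).ne').1 (hratio (hconn ω₀ ω))
  have hsum : ∑ ω, P ω = P ω₀ / φ ω₀ * ∑ ω, φ ω := by
    rw [Finset.mul_sum]
    exact Finset.sum_congr rfl fun ω _ => hPc ω
  have hc1 : P ω₀ / φ ω₀ = 1 := by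
    rw [hsumP, hsumφ, mul_one] at hsum
    exact hsum.symm
  rw [hPc ω₀, hc1, one_mul]

/-! ### Theorem 5: flip-extremality is automatic -/

/-- **Theorem 5 (extremality, the typed (EXT) shape).** Under the hypotheses of Theorem 4, if
`φ` is the midpoint of two probability laws `P₁`, `P₂` which are both flip-fair for the tilted
kernel of `φ`, then `P₁ = φ` (and symmetrically `P₂ = φ`): `φ` is *extremal* among flip-fair
laws.  This is immediate from uniqueness (Theorem 4); the midpoint hypothesis `P₁ + P₂ = φ + φ`,
as well as everything about `P₂`, is not even needed. -/
theorem extremal_of_flipFair_tilted {T : E → Ω → Ω} (hT : ∀ e ω, T e (T e ω) = ω)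
    {φ : Ω → ℝ} (hφ : ∀ ω, 0 < φ ω) {a : Ω → E → ℝ} (ha : ∀ ω e, a (T e ω) e = a ω e)
    (hsumφ : ∑ ω, φ ω = 1)
    (hconn : ∀ ω ω', Relation.ReflTransGen (fun x y => ∃ e, 0 < a x e ∧ y = T e x) ω ω')
    (P₁ P₂ : Ω → ℝ) (hsum₁ : ∑ ω, P₁ ω = 1) (_hsum₂ : ∑ ω, P₂ ω = 1)
    (h₁ : FlipFair T P₁ (tilted T φ a)) (_h₂ : FlipFair T P₂ (tilted T φ a))
    (_hmid : P₁ + P₂ = φ + φ) : P₁ = φ :=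
  eq_of_flipFair_tilted hT hφ ha hsumφ hconn hsum₁ h₁

/-! ### Theorem 6: the untilted identity is the fair-coin condition -/

/-- **Theorem 6 (where the content lives).** For the *untilted* kernel `w ω e := a ω e` with `a`
flip-symmetric (e.g. the pivotality indicator), the flip identity **(F)** is equivalent to
`a ω e * P (T e ω) = a ω e * P ω` for all `ω`, `e`: the law is invariant under every flip of
positive prefactor ("the coin at a pivotal edge is fair").  In contrast with Theorems 2 and 4,
this is a genuine restriction on `P` — the content of a Mecke-type axiom sits in the
normalisation of the kernel, not in the shape of the identity. -/
theorem flipFair_untilted_iff {T : E → Ω → Ω} (hT : ∀ e ω, T e (T e ω) = ω)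
    {a : Ω → E → ℝ} (ha : ∀ ω e, a (T e ω) e = a ω e) (P : Ω → ℝ) :
    FlipFair T P (fun ω e => a ω e) ↔ ∀ ω e, a ω e * P (T e ω) = a ω e * P ω := by
  rw [flipFair_iff_detailedBalance hT P (fun ω e => a ω e)]
  refine forall_congr' fun ω => forall_congr' fun e => ?_
  rw [ha, mul_comm (P (T e ω)), mul_comm (P ω)]

end FreeKernelNoContent
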